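import Summits.Ventures.Crystal3D.Theorems.StickyWulffConstantGenericWallFloorStarFarArith
import Summits.Ventures.Crystal3D.Theorems.StickyWulffConstantGenericWallFloorStarPairFar
import Summits.Ventures.Crystal3D.Theorems.StickyWulffConstantGenericWallFloorQuatSurjective
import HarnessLib

/-!
# Kernel discharge of `StarPairFar`, part 2: the test forms of the branch and bound (quaternion matrix,
# pair forms, moving-cage forms, certificate forms) and their real semantics

HONEST FRAMING. Venture `Summits/Ventures/Crystal3D` (cell `crystal3d-full`), helper `--supports` the crux
`GenericWallFloor` (stmt-Ventures-19480) of `route-Ventures-StickyWulffConstant`, line `WallLedgerG`.  Rung credit only;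
F-C1 not moved.  Milestone 2 of the kernel discharge of `StarPairFar` (R1), continued: every test of the interval branch
and bound (wulff-p2 g10 `starfar.py` scheme) is the sign of an INTEGER QUADRATIC FORM in the quaternion `q = (w,x,y,z)`
(`QF4` of part 1), built here from the LANDED data only — `clusterInt` (the walk cluster, × `√2` cubic frame), `starIdx`,
and the 46 star certificates `starDtCerts` (their `B`, `y0`, `useY`, `Ktot`):

* `NQ a b` — the entries of the quaternion matrix `N(q)` (`NQ_eval`: `= quatMat w x y z a b`), `NN` — `|q|²`;
* `linN coef = Σ coef_ab · N_ab`; `pairA i j = Fᵢᵀ N Fⱼ − |q|²`, `pairC i j = 2|q|² − Fᵢᵀ N Fⱼ` (pair test);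
  `movF j a = (N Fⱼ)_a` (moving-cage test);
* `certE c` — the certificate form `E_c = (18Kn − 3Kd)|q|² − 2Kn·Σ(3B)_ab N_ab` (`Ktot = Kn/Kd`),
  `certOK c` — the decidable integrality / positivity / orthogonality checks that make it faithful, and
  `certE_eval` — `E_c(q) = 3·(Kn·(6|q|² − 2ΣB_ab N_ab) − Kd·|q|²)` over `ℝ` when `certOK c`.
WHAT THIS IS NOT: the search procedures (part 3), their soundness (part 4), the evaluation, or `StarPairFar` itself.
-/

namespace Summit.Ventures.Crystal3D.Theorems.StarFar

open Summit.Ventures.Crystal3D.Theorems.NearIdentity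

/-! ### The quaternion matrix as nine integer quadratic forms -/

/-- The entry `N(q)_ab` of the quaternion rotation numerator as an integer quadratic form in `q = (w,x,y,z)`. -/
def NQ (a b : Fin 3) : QF4 :=
  match a, b with
  | 0, 0 => ⟨1, 0, 0, 0, 1, 0, 0, -1, 0, -1⟩
  | 0, 1 => ⟨0, 0, 0, -2, 0, 2, 0, 0, 0, 0⟩
  | 0, 2 => ⟨0, 0, 2, 0, 0, 0, 2, 0, 0, 0⟩
  | 1, 0 => ⟨0, 0, 0, 2, 0, 2, 0, 0, 0, 0⟩
  | 1, 1 => ⟨1, 0, 0, 0, -1, 0, 0, 1, 0, -1⟩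
  | 1, 2 => ⟨0, -2, 0, 0, 0, 0, 0, 0, 2, 0⟩
  | 2, 0 => ⟨0, 0, -2, 0, 0, 0, 2, 0, 0, 0⟩
  | 2, 1 => ⟨0, 2, 0, 0, 0, 0, 0, 0, 2, 0⟩
  | 2, 2 => ⟨1, 0, 0, 0, -1, 0, 0, -1, 0, 1⟩

/-- `|q|²` as an integer quadratic form. -/
def NN : QF4 := ⟨1, 0, 0, 0, 1, 0, 0, 1, 0, 1⟩

/-- `NQ a b` evaluates to the entry `quatMat w x y z a b`. -/
theorem NQ_eval (a b : Fin 3) (w x y z : ℝ) : (NQ a b).eval w x y z = quatMat w x y z a b := by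
  fin_cases a <;> fin_cases b <;> simp [quatMat, NQ, QF4.eval] <;> ring

/-- `NN` evaluates to `|q|²`. -/
theorem NN_eval (w x y z : ℝ) : NN.eval w x y z = w ^ 2 + x ^ 2 + y ^ 2 + z ^ 2 := by
  simp [NN, QF4.eval]; ring

/-- The integer combination `Σ_ab coef_ab · N_ab`. -/
def linN (coef : Fin 3 → Fin 3 → ℤ) : QF4 :=
  (((NQ 0 0).smul (coef 0 0)).add (((NQ 0 1).smul (coef 0 1)).add ((NQ 0 2).smul (coef 0 2)))).add
    ((((NQ 1 0).smul (coef 1 0)).add (((NQ 1 1).smul (coef 1 1)).add ((NQ 1 2).smul (coef 1 2)))).add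
      (((NQ 2 0).smul (coef 2 0)).add (((NQ 2 1).smul (coef 2 1)).add ((NQ 2 2).smul (coef 2 2)))))

/-- `linN coef` evaluates to `Σ_ab coef_ab · quatMat_ab`. -/
theorem linN_eval (coef : Fin 3 → Fin 3 → ℤ) (w x y z : ℝ) :
    (linN coef).eval w x y z = ∑ a : Fin 3, ∑ b : Fin 3, (coef a b : ℝ) * quatMat w x y z a b := by
  simp only [linN, QF4.eval_add, QF4.eval_smul, NQ_eval, Fin.sum_univ_three]
  ring

/-! ### The star data and the pair / moving-cage forms -/

/-- The walk cluster in the `× √2` cubic frame (integer vectors; `√2·cubicCoords (wPt i) = clusterInt i`). -/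
def FZ (i : Fin 13) (a : Fin 3) : ℤ := clusterInt i a

/-- The star indices as a list (`= starIdx`). -/
def starList : List (Fin 13) := [0, 5, 6, 9, 10]

/-- `starList` enumerates `starIdx`. -/
theorem mem_starList_iff (i : Fin 13) : i ∈ starList ↔ i ∈ starIdx := by
  revert i; decide

/-- Pair form `A_ij = Fᵢᵀ N Fⱼ − |q|²` (`> 0` ⇔ `|Fᵢ − M Fⱼ|² < 2`). -/
def pairA (i j : Fin 13) : QF4 := (linN fun a b => FZ i a * FZ j b).sub NN

/-- Pair form `C_ij = 2|q|² − Fᵢᵀ N Fⱼ` (`> 0` ⇔ `Fᵢ ≠ M Fⱼ`). -/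
def pairC (i j : Fin 13) : QF4 := (NN.smul 2).sub (linN fun a b => FZ i a * FZ j b)

/-- The bilinear value `Fᵢᵀ N(q) Fⱼ` over `ℝ`. -/
noncomputable def FNF (i j : Fin 13) (w x y z : ℝ) : ℝ :=
  ∑ a : Fin 3, ∑ b : Fin 3, (FZ i a : ℝ) * (FZ j b : ℝ) * quatMat w x y z a b

/-- Semantics of `pairA`. -/
theorem pairA_eval (i j : Fin 13) (w x y z : ℝ) :
    (pairA i j).eval w x y z = FNF i j w x y z - (w ^ 2 + x ^ 2 + y ^ 2 + z ^ 2) := by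
  simp only [pairA, QF4.eval_sub, linN_eval, NN_eval, FNF]; push_cast; ring

/-- Semantics of `pairC`. -/
theorem pairC_eval (i j : Fin 13) (w x y z : ℝ) :
    (pairC i j).eval w x y z = 2 * (w ^ 2 + x ^ 2 + y ^ 2 + z ^ 2) - FNF i j w x y z := by
  simp only [pairC, QF4.eval_sub, QF4.eval_smul, linN_eval, NN_eval, FNF]; push_cast; ring

/-- Moving-cage form: the component `(N(q) Fⱼ)_a`. -/
def movF (j : Fin 13) (a : Fin 3) : QF4 := linN fun a' b => if a' = a then FZ j b else 0

/-- The component `(N(q) Fⱼ)_a` over `ℝ`. -/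
noncomputable def NF (j : Fin 13) (a : Fin 3) (w x y z : ℝ) : ℝ := ∑ b : Fin 3, quatMat w x y z a b * (FZ j b : ℝ)

/-- Semantics of `movF`. -/
theorem movF_eval (j : Fin 13) (a : Fin 3) (w x y z : ℝ) : (movF j a).eval w x y z = NF j a w x y z := by
  rw [movF, linN_eval, NF]
  fin_cases a <;> simp [Fin.sum_univ_three] <;> ring

/-! ### The certificate records -/

/-- `3B` as an integer matrix (faithful when `certOK`). -/
def b3 (c : DTCert) (a b : Fin 3) : ℤ := (3 * c.B a b).num

/-- The certificate form `E_c`. -/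
def certE (c : DTCert) : QF4 :=
  (NN.smul (18 * c.Ktot.num - 3 * (c.Ktot.den : ℤ))).sub ((linN (b3 c)).smul (2 * c.Ktot.num))

/-- Faithfulness checks: `3B` and `y₀` integral, `Ktot > 0`, `B Bᵀ = 1`. -/
def certOK (c : DTCert) : Bool :=
  decide (∀ a b : Fin 3, (3 * c.B a b).den = 1) && decide (∀ a : Fin 3, (c.y0 a).den = 1) &&
    decide (0 < c.Ktot) && decide (∀ a b : Fin 3, ∑ l : Fin 3, c.B a l * c.B b l = if a = b then 1 else 0)

/-- All 46 star certificates pass `certOK`. -/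
def allCertOK : Bool := starDtCerts.all certOK

/-- A rational with denominator `1` is its numerator. -/
theorem cast_num_of_den_eq_one {q : ℚ} (h : q.den = 1) : ((q.num : ℤ) : ℝ) = ((q : ℚ) : ℝ) := by
  have hq : (q.num : ℚ) = q := Rat.coe_int_num_of_den_eq_one h
  have : ((q.num : ℚ) : ℝ) = ((q : ℚ) : ℝ) := by rw [hq]
  simpa using this

/-- Unpacking `certOK`. -/
theorem certOK_spec {c : DTCert} (h : certOK c = true) :
    (∀ a b : Fin 3, ((b3 c a b : ℤ) : ℝ) = 3 * ((c.B a b : ℚ) : ℝ)) ∧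
    (∀ a : Fin 3, (((c.y0 a).num : ℤ) : ℝ) = ((c.y0 a : ℚ) : ℝ)) ∧ 0 < c.Ktot ∧
    (∀ a b : Fin 3, ∑ l : Fin 3, ((c.B a l : ℚ) : ℝ) * ((c.B b l : ℚ) : ℝ) = if a = b then 1 else 0) := by
  simp only [certOK, Bool.and_eq_true, decide_eq_true_eq] at h
  obtain ⟨⟨⟨h1, h2⟩, h3⟩, h4⟩ := h
  refine ⟨fun a b => ?_, fun a => cast_num_of_den_eq_one (h2 a), h3, fun a b => ?_⟩
  · rw [b3, cast_num_of_den_eq_one (h1 a b)]; push_cast; ring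
  · have := h4 a b
    have hc : ((∑ l : Fin 3, c.B a l * c.B b l : ℚ) : ℝ) = ((if a = b then 1 else 0 : ℚ) : ℝ) := by rw [this]
    push_cast at hc
    rw [hc]; split_ifs <;> simp

/-- **Semantics of the certificate form**: `E_c(q) = 3·(Kn·(6|q|² − 2·Σ_ab B_ab N(q)_ab) − Kd·|q|²)`. -/
theorem certE_eval {c : DTCert} (h : certOK c = true) (w x y z : ℝ) :
    (certE c).eval w x y z =
      3 * ((c.Ktot.num : ℝ) * (6 * (w ^ 2 + x ^ 2 + y ^ 2 + z ^ 2) -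
        2 * ∑ a : Fin 3, ∑ b : Fin 3, ((c.B a b : ℚ) : ℝ) * quatMat w x y z a b) -
        (c.Ktot.den : ℝ) * (w ^ 2 + x ^ 2 + y ^ 2 + z ^ 2)) := by
  obtain ⟨hB, -, -, -⟩ := certOK_spec h
  simp only [certE, QF4.eval_sub, QF4.eval_smul, NN_eval, linN_eval, hB, Fin.sum_univ_three]
  push_cast
  ring

end Summit.Ventures.Crystal3D.Theorems.StarFar
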